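import Summits.BirchSwinnertonDyer.Rank1Residual.GaloisImage.KolyvaginSystemOfEulerSystemPropagated
import Summits.BirchSwinnertonDyer.Rank1Residual.GaloisImage.KolyvaginDerivativeCoefficientChange
import Summits.BirchSwinnertonDyer.Rank1Residual.GaloisImage.TorsionPadicIntCoefficientsLocal
import HarnessLib

/-!
# ONE Euler system, TWO depths: the Kolyvagin systems of an Euler system of `T_p E / ℚ` at the
# depths `k ≤ m` are COMPATIBLE under the reduction `E[p^m·p] → E[p^k·p]`, `x ↦ p^{m−k} x`
# (cell `b2b-bsdres`, n1011 p11 GEN 10; row T-DER, THEOREM D file D7 — the (COMP) clause of the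
# two-level PORT `KatoKuriharaDictionaryThreeAt₂`)

HONEST FRAMING (cell `b2b-bsdres`, run/shared/lean/b2b/bsd-rank1-residual/, verbatim in every
file): the goal of the cell is to DELETE the COMBINATION-SHAPED residual classes of the
Birch–Swinnerton-Dyer formula for ALL analytic-rank `≤ 1` elliptic curves over `ℚ` — "full BSD
formula for every rank `≤ 1` curve in class `C`" assembled STRICTLY from published theorems — so
that the rank-`≤ 1` remainder becomes exactly the CONSTRUCTION-SHAPED classes, which are TYPED
(missing-input `Prop`s), NOT attempted. This is not "finishing BSD". Team n1011: research route on
the CONSTRUCTION-SHAPED class X4 / §I N11 (route-1 PORT, (P-DER), clauses C0/C1/(COMP)); TOOL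
theorem.  HONEST LIMITS: NO Euler system is asserted to exist (hypothesis `hc`); the value clauses
are NOT here; the row-class certificates (`hbad`, `htop` at BOTH depths) are DISPLAYED.  No definition,
no named fact, no `sorry`.

## What

* `comp_map_red_oneCocycleClass_of_comp` — the merged transport `Φ_U ∘ red_* : H¹(U, T_pE) →
  H¹(U, E[M])` is computed on cocycles by `a ↦ a_j` when `e ∘ red = (a ↦ a_j)` (`hcomp`); general `p`
  (the `p = 3` instance is D5b's `comp_map_red_oneCocycleClass`).
* `map_derivativeFamily_eq` — for two derivative families `κ″` (depth `m`, coefficient system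
  `(T″, red″, e″)`) and `κ` (depth `k ≤ m`, `(T′, red′, e′)`, WITH its uniqueness) of the SAME Euler
  system and the SAME generators `σ` (D2 `exists_derivativeFamily` ×2), and the reduction
  `π : E[p^m·p] → E[p^k·p]`, `x ↦ p^{m−k} x` (`hπ`): **`π_* (κ″ d) = κ d`** at every level — n1011-p13's
  T-DER-BP FILE 4 `CoeffChange.EC.map_eq_of_res_eq_deriv` (Rubin, *Euler Systems* Def. 4.4.4 /
  Lemma 4.4.2; the tree's `galoisCohomology.map π 1` IS `ContinuousCohomology.map id π 1`).
* END **`exists_isKolyvaginSystem_pair_propagatedSelmerStructure`** — D4 at the two depths from ONE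
  `σ` (D1) plus (COMP): `∃ σ κ κ″`, `D.IsKolyvaginSystem (𝓕_can,k) κ`, `D″.IsKolyvaginSystem (𝓕_can,m) κ″`,
  `∀ d ⊆ 𝒫 ∩ 𝒫″, π_* (κ″ d) = κ d`, with the derivative characterisations (transports `Φ`, `Φ″`).
References: B. Mazur, K. Rubin, Mem. AMS 799 (2004), Thm. 3.2.4, App. A; K. Rubin, *Euler Systems*
(2000), Def. 4.4.4, Lemma 4.4.2; C.-H. Kim, arXiv:2203.12159, Thm. 3.13 (the two-level dictionary).
-/

noncomputable section

open CategoryTheory Function Finset Polynomial Field IsDedekindDomain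
open scoped NumberField Classical ContRepresentation
open Literature.NumberTheory.GaloisRepresentations Literature.NumberTheory.EllipticCurves
open Literature.NumberTheory.GaloisRepresentations.DiscreteGaloisModule
open Literature.NumberTheory.GaloisCohomology
open Summit.BirchSwinnertonDyer.Rank1Residual.GaloisImage.CoeffTransport
open Summit.BirchSwinnertonDyer.Rank1Residual.GaloisImage.CyclotomicLevel
open Rat.HeightOneSpectrum WeierstrassCurve TateModule

universe u

namespace Summit.BirchSwinnertonDyer.Rank1Residual.GaloisImage.Derivative.Rat

variable (W : WeierstrassCurve ℚ) [W.IsElliptic] [W.IsGloballyMinimal] (p : ℕ) [Fact p.Prime]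
variable [Module.Free ℤ_[p] (W.tateModule p)] [Module.Finite ℤ_[p] (W.tateModule p)]
  [ContinuousSMul ℤ_[p] (W.tateModule p)]

/-- Local notation: `T∞ = T_p E` as a continuous `G_ℚ`-representation. -/
local notation3 "T∞" => WeierstrassCurve.tateGaloisRep W p (W.continuous_galoisRepTate_holds p)

/-- Local notation: `𝐫⟦f, T′, U⟧ = f_* : H¹(U, T_pE) → H¹(U, T′)`. -/
local notation3 (prettyPrint := false) "𝐫⟦" f ", " Tg ", " U "⟧" =>
  ContinuousCohomology.map (ContinuousMonoidHom.id _)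
    (X := subgroupRep (ContinuousRep.toTopRep T∞) U)
    (Y := subgroupRep (ContinuousRep.toTopRep Tg) U)
    ((TopRep.resFunctor (Subgroup.subtype U)).map f) 1

variable (S : Set (HeightOneSpectrum (𝓞 ℚ)))

/-- Local notation: `𝓛` = the cyclotomic Euler-system levels `ℚ(μ_{p^{n+1}}, μ_r)`, `r ∩ S = ∅`. -/
local notation3 "𝓛" => cyclotomicLevelsRat p S

/-- Local notation: `𝐃⟦A, X, U, τ⟧ ℓ = ∑_{j < ℓ−1} j·(τ_ℓ)_*^j`, Kolyvagin's derivative operator. -/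
local notation3 (prettyPrint := false) "𝐃⟦" A ", " X ", " U ", " τ "⟧" =>
  fun ℓ : HeightOneSpectrum (𝓞 ℚ) =>
  ∑ j ∈ Finset.range (((primesEquiv ℓ : Nat.Primes) : ℕ) - 1),
    (j : Module.End A (continuousCohomology 1 (subgroupRep X U))) *
      (conjMap X U ((τ : HeightOneSpectrum (𝓞 ℚ) → absoluteGaloisGroup ℚ) ℓ) 1).hom.toLinearMap ^ j

omit [W.IsElliptic] [W.IsGloballyMinimal] [Module.Free ℤ_[p] (W.tateModule p)]
  [Module.Finite ℤ_[p] (W.tateModule p)] in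
/-- **The merged transport `Φ_U ∘ red_*` is computed on cocycles by `a ↦ a_j`** when `e ∘ red = a ↦ a_j`
(`hcomp`) — general `p` (D5b's `comp_map_red_oneCocycleClass` is `p = 3`). [folklore] -/
theorem comp_map_red_oneCocycleClass_of_comp {M' : Type} [AddCommGroup M'] [Module ℤ_[p] M']
    [TopologicalSpace M'] [IsTopologicalAddGroup M'] [ContinuousSMul ℤ_[p] M']
    {T' : GaloisRep ℚ ℤ_[p] M'} (red : T∞.toTopRep ⟶ T'.toTopRep) {j : ℕ} {M : ℤ}
    (e : M' →+ WeierstrassCurve.geomTorsion W M)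
    (hcomp : ∀ a : W.tateModule p, ((e (red.hom a) : geomTorsion W M) : geomPoints W) = proj p j a)
    (U : Subgroup (absoluteGaloisGroup ℚ))
    (Φ : continuousCohomology 1 (subgroupRep T'.toTopRep U) →+
      continuousCohomology 1 (subgroupRep (W.torsionGaloisModule M).toTopRep U))
    (hΦ : ∀ (φ : contOneCocycles (subgroupRep T'.toTopRep U))
      (ψ : contOneCocycles (subgroupRep (W.torsionGaloisModule M).toTopRep U)),
      (∀ g, ψ.1 g = e (φ.1 g)) → Φ (oneCocycleClass _ φ) = oneCocycleClass _ ψ)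
    (φ : contOneCocycles (subgroupRep T∞.toTopRep U))
    (ψ : contOneCocycles (subgroupRep (W.torsionGaloisModule M).toTopRep U))
    (hψ : ∀ g, ((ψ.1 g : geomTorsion W M) : geomPoints W) = proj p j (φ.1 g)) :
    Φ (𝐫⟦red, T', U⟧ (oneCocycleClass _ φ)) = oneCocycleClass _ ψ := by
  rw [red_oneCocycleClass red U φ]
  refine hΦ _ ψ fun g => Subtype.ext ?_
  rw [hψ g]
  exact (hcomp (φ.1 g)).symm

omit [W.IsElliptic] [W.IsGloballyMinimal] [Module.Free ℤ_[p] (W.tateModule p)]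
  [Module.Finite ℤ_[p] (W.tateModule p)] in
/-- **ONE Euler system, TWO depths: `π_* κ″_d = κ_d`.**  Two derivative families of the SAME Euler
system `c` with the SAME generators `σ` — `κ″` at depth `m` (coefficients `(T″, red″, e″)` reading
`a ↦ a_{m+1}`) and `κ` at depth `k ≤ m` (`(T′, red′, e′)` reading `a ↦ a_{k+1}`, UNIQUE at every
level, D2) — are compatible under the reduction `π : E[p^m·p] → E[p^k·p]`, `x ↦ p^{m−k} x`:
`galoisCohomology.map π 1 (κ″ d) = κ d` at every common level.  T-DER-BP FILE 4
`CoeffChange.EC.map_eq_of_res_eq_deriv` (n1011-p13) with the merged transports.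
[cite: Rubin2000, Def. 4.4.4 and Lemma 4.4.2] [cite: Kim2022StructureSelmer, Thm. 3.13] -/
theorem map_derivativeFamily_eq {k m : ℕ} (hkm : k ≤ m)
    {c : ∀ (i : ℕ) (r : (𝓛).Ideals), H1 T∞ ((𝓛).level i r.1)}
    -- depth `k`
    {M' : Type} [AddCommGroup M'] [Module ℤ_[p] M'] [TopologicalSpace M'] [IsTopologicalAddGroup M']
    [ContinuousSMul ℤ_[p] M'] {T' : GaloisRep ℚ ℤ_[p] M'} (red : T∞.toTopRep ⟶ T'.toTopRep)
    (e : M' →+ WeierstrassCurve.geomTorsion W ((p : ℤ) ^ k * (p : ℤ)))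
    (hcomp : ∀ a : W.tateModule p,
      ((e (red.hom a) : geomTorsion W ((p : ℤ) ^ k * (p : ℤ))) : geomPoints W) = proj p (k + 1) a)
    -- depth `m`
    {M'' : Type} [AddCommGroup M''] [Module ℤ_[p] M''] [TopologicalSpace M'']
    [IsTopologicalAddGroup M''] [ContinuousSMul ℤ_[p] M''] {T'' : GaloisRep ℚ ℤ_[p] M''}
    (red'' : T∞.toTopRep ⟶ T''.toTopRep)
    (e'' : M'' →+ WeierstrassCurve.geomTorsion W ((p : ℤ) ^ m * (p : ℤ)))
    (hcomp'' : ∀ a : W.tateModule p,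
      ((e'' (red''.hom a) : geomTorsion W ((p : ℤ) ^ m * (p : ℤ))) : geomPoints W) = proj p (m + 1) a)
    (π : (W.torsionGaloisModule ((p : ℤ) ^ m * (p : ℤ))).toContRepresentation →ⁱL
      (W.torsionGaloisModule ((p : ℤ) ^ k * (p : ℤ))).toContRepresentation)
    (hπ : ∀ x : geomTorsion W ((p : ℤ) ^ m * (p : ℤ)),
      ((π x : geomTorsion W ((p : ℤ) ^ k * (p : ℤ))) : geomPoints W) =
        ((p : ℤ) ^ (m - k)) • (x : geomPoints W))
    (Pr : Set (HeightOneSpectrum (𝓞 ℚ))) (hPr : Pr ⊆ (𝓛).primes)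
    (σ : HeightOneSpectrum (𝓞 ℚ) → absoluteGaloisGroup ℚ)
    (Φ : ∀ r : Finset (HeightOneSpectrum (𝓞 ℚ)),
        continuousCohomology 1 (subgroupRep T'.toTopRep ((𝓛).level ⊥ r)) →+
          continuousCohomology 1 (subgroupRep
            (W.torsionGaloisModule ((p : ℤ) ^ k * (p : ℤ))).toTopRep ((𝓛).level ⊥ r)))
    (hΦ : ∀ r, ∀ (φ : contOneCocycles (subgroupRep T'.toTopRep ((𝓛).level ⊥ r)))
      (ψ : contOneCocycles (subgroupRep
        (W.torsionGaloisModule ((p : ℤ) ^ k * (p : ℤ))).toTopRep ((𝓛).level ⊥ r))),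
      (∀ g, ψ.1 g = e (φ.1 g)) → Φ r (oneCocycleClass _ φ) = oneCocycleClass _ ψ)
    (comm : ∀ r : Finset (HeightOneSpectrum (𝓞 ℚ)),
        ((r : Finset _) : Set (HeightOneSpectrum (𝓞 ℚ))).Pairwise fun a b =>
          Commute (𝐃⟦ℤ, (W.torsionGaloisModule ((p : ℤ) ^ k * (p : ℤ))).toTopRep, ((𝓛).level ⊥ r), σ⟧ a)
            (𝐃⟦ℤ, (W.torsionGaloisModule ((p : ℤ) ^ k * (p : ℤ))).toTopRep, ((𝓛).level ⊥ r), σ⟧ b))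
    (κ : Finset (HeightOneSpectrum (𝓞 ℚ)) → galoisCohomology (W.torsionGaloisModule ((p : ℤ) ^ k * (p : ℤ))) 1)
    (hκ : ∀ (r : Finset (HeightOneSpectrum (𝓞 ℚ))) (hr : (↑r : Set _) ⊆ Pr),
      resSubgroup (W.torsionGaloisModule ((p : ℤ) ^ k * (p : ℤ))).toTopRep ((𝓛).level ⊥ r) 1 (κ r) =
        (r.noncommProd 𝐃⟦ℤ, (W.torsionGaloisModule ((p : ℤ) ^ k * (p : ℤ))).toTopRep, ((𝓛).level ⊥ r), σ⟧
          (comm r)) (Φ r (𝐫⟦red, T', ((𝓛).level ⊥ r)⟧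
            (c ⊥ ⟨r, fun _ hq => hPr (hr (Finset.mem_coe.2 hq))⟩))) ∧
      ∀ κ₁ : galoisCohomology (W.torsionGaloisModule ((p : ℤ) ^ k * (p : ℤ))) 1,
        resSubgroup (W.torsionGaloisModule ((p : ℤ) ^ k * (p : ℤ))).toTopRep ((𝓛).level ⊥ r) 1 κ₁ =
          (r.noncommProd 𝐃⟦ℤ, (W.torsionGaloisModule ((p : ℤ) ^ k * (p : ℤ))).toTopRep, ((𝓛).level ⊥ r), σ⟧
            (comm r)) (Φ r (𝐫⟦red, T', ((𝓛).level ⊥ r)⟧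
              (c ⊥ ⟨r, fun _ hq => hPr (hr (Finset.mem_coe.2 hq))⟩))) → κ₁ = κ r)
    (Φ'' : ∀ r : Finset (HeightOneSpectrum (𝓞 ℚ)),
        continuousCohomology 1 (subgroupRep T''.toTopRep ((𝓛).level ⊥ r)) →+
          continuousCohomology 1 (subgroupRep
            (W.torsionGaloisModule ((p : ℤ) ^ m * (p : ℤ))).toTopRep ((𝓛).level ⊥ r)))
    (hΦ'' : ∀ r, ∀ (φ : contOneCocycles (subgroupRep T''.toTopRep ((𝓛).level ⊥ r)))
      (ψ : contOneCocycles (subgroupRep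
        (W.torsionGaloisModule ((p : ℤ) ^ m * (p : ℤ))).toTopRep ((𝓛).level ⊥ r))),
      (∀ g, ψ.1 g = e'' (φ.1 g)) → Φ'' r (oneCocycleClass _ φ) = oneCocycleClass _ ψ)
    (comm'' : ∀ r : Finset (HeightOneSpectrum (𝓞 ℚ)),
        ((r : Finset _) : Set (HeightOneSpectrum (𝓞 ℚ))).Pairwise fun a b =>
          Commute (𝐃⟦ℤ, (W.torsionGaloisModule ((p : ℤ) ^ m * (p : ℤ))).toTopRep, ((𝓛).level ⊥ r), σ⟧ a)
            (𝐃⟦ℤ, (W.torsionGaloisModule ((p : ℤ) ^ m * (p : ℤ))).toTopRep, ((𝓛).level ⊥ r), σ⟧ b))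
    (κ'' : Finset (HeightOneSpectrum (𝓞 ℚ)) →
      galoisCohomology (W.torsionGaloisModule ((p : ℤ) ^ m * (p : ℤ))) 1)
    (hκ'' : ∀ (r : Finset (HeightOneSpectrum (𝓞 ℚ))) (hr : (↑r : Set _) ⊆ Pr),
      resSubgroup (W.torsionGaloisModule ((p : ℤ) ^ m * (p : ℤ))).toTopRep ((𝓛).level ⊥ r) 1 (κ'' r) =
        (r.noncommProd 𝐃⟦ℤ, (W.torsionGaloisModule ((p : ℤ) ^ m * (p : ℤ))).toTopRep, ((𝓛).level ⊥ r), σ⟧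
          (comm'' r)) (Φ'' r (𝐫⟦red'', T'', ((𝓛).level ⊥ r)⟧
            (c ⊥ ⟨r, fun _ hq => hPr (hr (Finset.mem_coe.2 hq))⟩))))
    (d : Finset (HeightOneSpectrum (𝓞 ℚ))) (hd : (↑d : Set _) ⊆ Pr) :
    galoisCohomology.map π 1 (κ'' d) = κ d := by
  have hMm : geomTorsion W ((p ^ (m + 1) : ℕ) : ℤ) = geomTorsion W ((p : ℤ) ^ m * (p : ℤ)) :=
    TorsionCoeff.geomTorsion_pow_succ_eq W p m
  have hMk : geomTorsion W ((p ^ (k + 1) : ℕ) : ℤ) = geomTorsion W ((p : ℤ) ^ k * (p : ℤ)) :=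
    TorsionCoeff.geomTorsion_pow_succ_eq W p k
  exact CoeffChange.EC.map_eq_of_res_eq_deriv W p (W.continuous_galoisRepTate_holds p) hkm hMm hMk
    (TopRep.ofHom ⟨π.toContinuousLinearMap, π.isIntertwining'⟩) (fun x => hπ x) ((𝓛).level ⊥ d) σ
    (fun ℓ => ((primesEquiv ℓ : Nat.Primes) : ℕ) - 1) d (comm'' d) (comm d)
    (c ⊥ ⟨d, fun _ hq => hPr (hd (Finset.mem_coe.2 hq))⟩)
    ((Φ'' d).comp (𝐫⟦red'', T'', ((𝓛).level ⊥ d)⟧).hom.toAddMonoidHom)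
    (fun φ ψ hψ => comp_map_red_oneCocycleClass_of_comp W p red'' e'' hcomp'' _ (Φ'' d) (hΦ'' d) φ ψ hψ)
    ((Φ d).comp (𝐫⟦red, T', ((𝓛).level ⊥ d)⟧).hom.toAddMonoidHom)
    (fun φ ψ hψ => comp_map_red_oneCocycleClass_of_comp W p red e hcomp _ (Φ d) (hΦ d) φ ψ hψ)
    (κ'' d) (hκ'' d hd) ⟨κ d, (hκ d hd).1, fun κ₁ h => (hκ d hd).2 κ₁ h⟩ (κ d) (hκ d hd).1

/-- **THEOREM D at TWO depths with (COMP)** — the structural clauses of the two-level PORT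
`KatoKuriharaDictionaryThreeAt₂` (C0/C1 at depths `k ≤ m` and the compatibility (COMP)
`π_* κ″_d = κ_d`), for `𝓕_can` at both depths, from ONE Euler system of `T_pE` (hypothesis `hc`),
ONE generator family (both datums use the same primitive roots `η`), Irr(E[p]), and the row-class
certificates at both depths (`hbad`; `htop`, `htop″`).  See D4 for every single-depth binder.
[cite: MazurRubin2004, Thm. 3.2.4 and App. A] [cite: Rubin2000, Def. 4.4.4, Lemma 4.4.2, Thm. 4.5.4]
[cite: Kim2022StructureSelmer, Thm. 3.13 and §2.2.2] -/
theorem exists_isKolyvaginSystem_pair_propagatedSelmerStructure (hp2 : p ≠ 2) {k m : ℕ} (hkm : k ≤ m)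
    {c : ∀ (i : ℕ) (r : (𝓛).Ideals), H1 T∞ ((𝓛).level i r.1)}
    (hc : IsEulerSystem 𝓛 T∞ p c)
    -- depth `k`
    {M' : Type} [AddCommGroup M'] [Module ℤ_[p] M'] [TopologicalSpace M'] [DiscreteTopology M']
    [IsTopologicalAddGroup M'] [ContinuousSMul ℤ_[p] M'] {T' : GaloisRep ℚ ℤ_[p] M'}
    (red : T∞.toTopRep ⟶ T'.toTopRep) (hred : Function.Surjective red.hom)
    (hM : ∀ x : M', ((p : ℤ_[p]) ^ (k + 1)) • x = 0)
    (e : M' →+ WeierstrassCurve.geomTorsion W ((p : ℤ) ^ k * (p : ℤ))) (hec : Continuous e)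
    (he : ∀ (g : absoluteGaloisGroup ℚ) (x : M'),
      e (T'.toTopRep.ρ g x) = (W.torsionGaloisModule ((p : ℤ) ^ k * (p : ℤ))).toTopRep.ρ g (e x))
    (einv : WeierstrassCurve.geomTorsion W ((p : ℤ) ^ k * (p : ℤ)) →+ M') (hic : Continuous einv)
    (h₁ : ∀ x, einv (e x) = x) (h₂ : ∀ y, e (einv y) = y)
    (hcomp : ∀ a : W.tateModule p,
      ((e (red.hom a) : geomTorsion W ((p : ℤ) ^ k * (p : ℤ))) : geomPoints W) = proj p (k + 1) a)
    -- depth `m`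
    {M'' : Type} [AddCommGroup M''] [Module ℤ_[p] M''] [TopologicalSpace M''] [DiscreteTopology M'']
    [IsTopologicalAddGroup M''] [ContinuousSMul ℤ_[p] M''] {T'' : GaloisRep ℚ ℤ_[p] M''}
    (red'' : T∞.toTopRep ⟶ T''.toTopRep) (hred'' : Function.Surjective red''.hom)
    (hM'' : ∀ x : M'', ((p : ℤ_[p]) ^ (m + 1)) • x = 0)
    (e'' : M'' →+ WeierstrassCurve.geomTorsion W ((p : ℤ) ^ m * (p : ℤ))) (hec'' : Continuous e'')
    (he'' : ∀ (g : absoluteGaloisGroup ℚ) (x : M''),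
      e'' (T''.toTopRep.ρ g x) = (W.torsionGaloisModule ((p : ℤ) ^ m * (p : ℤ))).toTopRep.ρ g (e'' x))
    (einv'' : WeierstrassCurve.geomTorsion W ((p : ℤ) ^ m * (p : ℤ)) →+ M'') (hic'' : Continuous einv'')
    (h₁'' : ∀ x, einv'' (e'' x) = x) (h₂'' : ∀ y, e'' (einv'' y) = y)
    (hcomp'' : ∀ a : W.tateModule p,
      ((e'' (red''.hom a) : geomTorsion W ((p : ℤ) ^ m * (p : ℤ))) : geomPoints W) = proj p (m + 1) a)
    (π : (W.torsionGaloisModule ((p : ℤ) ^ m * (p : ℤ))).toContRepresentation →ⁱL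
      (W.torsionGaloisModule ((p : ℤ) ^ k * (p : ℤ))).toContRepresentation)
    (hπ : ∀ x : geomTorsion W ((p : ℤ) ^ m * (p : ℤ)),
      ((π x : geomTorsion W ((p : ℤ) ^ k * (p : ℤ))) : geomPoints W) =
        ((p : ℤ) ^ (m - k)) • (x : geomPoints W))
    -- the curve and the two datums (same primitive roots `η`)
    (hirr : W.HasIrreducibleModPGaloisRep p)
    (D : KolyvaginDatum (W.torsionGaloisModule ((p : ℤ) ^ k * (p : ℤ))))
    (hT : D.transverse = cyclotomicTransverse (W.torsionGaloisModule ((p : ℤ) ^ k * (p : ℤ))))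
    (D'' : KolyvaginDatum (W.torsionGaloisModule ((p : ℤ) ^ m * (p : ℤ))))
    (hT'' : D''.transverse = cyclotomicTransverse (W.torsionGaloisModule ((p : ℤ) ^ m * (p : ℤ))))
    {η : (ℓ : HeightOneSpectrum (𝓞 ℚ)) → (ZMod (Ideal.absNorm ℓ.asIdeal))ˣ}
    (hD : D.HasCanonicalComparison (p ^ (k + 1)) η) (hD'' : D''.HasCanonicalComparison (p ^ (m + 1)) η)
    (hPr : D.primes ⊆ (𝓛).primes) (hPr'' : D''.primes ⊆ (𝓛).primes)
    (hKol : ∀ ℓ ∈ D.primes, Kato.IsKolyvaginPrime W p (k + 1) ((primesEquiv ℓ : Nat.Primes) : ℕ))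
    (hKol'' : ∀ ℓ ∈ D''.primes, Kato.IsKolyvaginPrime W p (m + 1) ((primesEquiv ℓ : Nat.Primes) : ℕ))
    (hbad : ∀ w : HeightOneSpectrum (𝓞 ℚ), ¬ W.HasGoodReductionAt w →
      ((primesEquiv w : Nat.Primes) : ℕ) ≠ p →
        ∀ P : (W.baseChange (w.adicCompletion ℚ)).toAffine.Point, p • P = 0 → P = 0)
    (htop : ∀ w : HeightOneSpectrum (𝓞 ℚ), ((primesEquiv w : Nat.Primes) : ℕ) = p →
      propagatedSelmerStructure W p k (Sum.inr w) = ⊤)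
    (htop'' : ∀ w : HeightOneSpectrum (𝓞 ℚ), ((primesEquiv w : Nat.Primes) : ℕ) = p →
      propagatedSelmerStructure W p m (Sum.inr w) = ⊤) :
    ∃ (σ : HeightOneSpectrum (𝓞 ℚ) → absoluteGaloisGroup ℚ)
      (Φ : ∀ r : Finset (HeightOneSpectrum (𝓞 ℚ)),
        continuousCohomology 1 (subgroupRep T'.toTopRep ((𝓛).level ⊥ r)) →+
          continuousCohomology 1 (subgroupRep
            (W.torsionGaloisModule ((p : ℤ) ^ k * (p : ℤ))).toTopRep ((𝓛).level ⊥ r)))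
      (comm : ∀ r : Finset (HeightOneSpectrum (𝓞 ℚ)),
        ((r : Finset _) : Set (HeightOneSpectrum (𝓞 ℚ))).Pairwise fun a b =>
          Commute (𝐃⟦ℤ, (W.torsionGaloisModule ((p : ℤ) ^ k * (p : ℤ))).toTopRep, ((𝓛).level ⊥ r), σ⟧ a)
            (𝐃⟦ℤ, (W.torsionGaloisModule ((p : ℤ) ^ k * (p : ℤ))).toTopRep, ((𝓛).level ⊥ r), σ⟧ b))
      (κ : Finset (HeightOneSpectrum (𝓞 ℚ)) → galoisCohomology (W.torsionGaloisModule ((p : ℤ) ^ k * (p : ℤ))) 1)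
      (Φ'' : ∀ r : Finset (HeightOneSpectrum (𝓞 ℚ)),
        continuousCohomology 1 (subgroupRep T''.toTopRep ((𝓛).level ⊥ r)) →+
          continuousCohomology 1 (subgroupRep
            (W.torsionGaloisModule ((p : ℤ) ^ m * (p : ℤ))).toTopRep ((𝓛).level ⊥ r)))
      (comm'' : ∀ r : Finset (HeightOneSpectrum (𝓞 ℚ)),
        ((r : Finset _) : Set (HeightOneSpectrum (𝓞 ℚ))).Pairwise fun a b =>
          Commute (𝐃⟦ℤ, (W.torsionGaloisModule ((p : ℤ) ^ m * (p : ℤ))).toTopRep, ((𝓛).level ⊥ r), σ⟧ a)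
            (𝐃⟦ℤ, (W.torsionGaloisModule ((p : ℤ) ^ m * (p : ℤ))).toTopRep, ((𝓛).level ⊥ r), σ⟧ b))
      (κ'' : Finset (HeightOneSpectrum (𝓞 ℚ)) →
        galoisCohomology (W.torsionGaloisModule ((p : ℤ) ^ m * (p : ℤ))) 1),
      (∀ ℓ, σ ℓ ∈ (adicCompletionPrime ℚ ℓ).inertia (absoluteGaloisGroup ℚ)) ∧
      (∀ ℓ, modNCyclotomicCharacter ℚ (Ideal.absNorm ℓ.asIdeal) (σ ℓ) = η ℓ) ∧
      (∀ r, ∀ (φ : contOneCocycles (subgroupRep T'.toTopRep ((𝓛).level ⊥ r)))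
        (ψ : contOneCocycles (subgroupRep
          (W.torsionGaloisModule ((p : ℤ) ^ k * (p : ℤ))).toTopRep ((𝓛).level ⊥ r))),
        (∀ g, ψ.1 g = e (φ.1 g)) → Φ r (oneCocycleClass _ φ) = oneCocycleClass _ ψ) ∧
      (∀ r, ∀ (φ : contOneCocycles (subgroupRep T''.toTopRep ((𝓛).level ⊥ r)))
        (ψ : contOneCocycles (subgroupRep
          (W.torsionGaloisModule ((p : ℤ) ^ m * (p : ℤ))).toTopRep ((𝓛).level ⊥ r))),
        (∀ g, ψ.1 g = e'' (φ.1 g)) → Φ'' r (oneCocycleClass _ φ) = oneCocycleClass _ ψ) ∧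
      D.IsKolyvaginSystem (propagatedSelmerStructure W p k) κ ∧
      D''.IsKolyvaginSystem (propagatedSelmerStructure W p m) κ'' ∧
      (∀ r : Finset (HeightOneSpectrum (𝓞 ℚ)), ¬ (↑r : Set _) ⊆ D.primes → κ r = 0) ∧
      (∀ r : Finset (HeightOneSpectrum (𝓞 ℚ)), ¬ (↑r : Set _) ⊆ D''.primes → κ'' r = 0) ∧
      (∀ (r : Finset (HeightOneSpectrum (𝓞 ℚ))) (hr : (↑r : Set _) ⊆ D.primes),
        resSubgroup (W.torsionGaloisModule ((p : ℤ) ^ k * (p : ℤ))).toTopRep ((𝓛).level ⊥ r) 1 (κ r) =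
          (r.noncommProd 𝐃⟦ℤ, (W.torsionGaloisModule ((p : ℤ) ^ k * (p : ℤ))).toTopRep, ((𝓛).level ⊥ r), σ⟧
            (comm r)) (Φ r (𝐫⟦red, T', ((𝓛).level ⊥ r)⟧
              (c ⊥ ⟨r, fun _ hq => hPr (hr (Finset.mem_coe.2 hq))⟩)))) ∧
      (∀ (r : Finset (HeightOneSpectrum (𝓞 ℚ))) (hr : (↑r : Set _) ⊆ D''.primes),
        resSubgroup (W.torsionGaloisModule ((p : ℤ) ^ m * (p : ℤ))).toTopRep ((𝓛).level ⊥ r) 1 (κ'' r) =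
          (r.noncommProd 𝐃⟦ℤ, (W.torsionGaloisModule ((p : ℤ) ^ m * (p : ℤ))).toTopRep, ((𝓛).level ⊥ r), σ⟧
            (comm'' r)) (Φ'' r (𝐫⟦red'', T'', ((𝓛).level ⊥ r)⟧
              (c ⊥ ⟨r, fun _ hq => hPr'' (hr (Finset.mem_coe.2 hq))⟩)))) ∧
      ∀ d : Finset (HeightOneSpectrum (𝓞 ℚ)), (↑d : Set _) ⊆ D.primes → (↑d : Set _) ⊆ D''.primes →
        galoisCohomology.map π 1 (κ'' d) = κ d := by
  have hmk : (p : ℤ) ^ k * (p : ℤ) = ((p ^ (k + 1) : ℕ) : ℤ) := by push_cast; ring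
  have hmm : (p : ℤ) ^ m * (p : ℤ) = ((p ^ (m + 1) : ℕ) : ℤ) := by push_cast; ring
  -- ONE generator family for both datums (D1 on `𝒫 ∪ 𝒫″`)
  obtain ⟨σ, hσI, hσχ, -, hσ⟩ := CyclotomicLevel.Rat.exists_sigma_mem_inertia_adicCompletionPrime p S η
    (D.primes ∪ D''.primes) (fun ℓ hℓ => hℓ.elim (fun h => hD.zpowers_eq_top h)
      (fun h => hD''.zpowers_eq_top h))
  have hσk : ∀ r : Finset (HeightOneSpectrum (𝓞 ℚ)), (↑r : Set _) ⊆ D.primes → _ :=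
    fun r hr => hσ r (hr.trans Set.subset_union_left)
  have hσm : ∀ r : Finset (HeightOneSpectrum (𝓞 ℚ)), (↑r : Set _) ⊆ D''.primes → _ :=
    fun r hr => hσ r (hr.trans Set.subset_union_right)
  -- `h0` at both depths from `Irr(E[p])`
  have h0k : ∀ r : Finset (HeightOneSpectrum (𝓞 ℚ)), (↑r : Set _) ⊆ D.primes →
      ∀ P : WeierstrassCurve.geomTorsion W ((p : ℤ) ^ k * (p : ℤ)),
        (∀ u : (𝓛).level ⊥ r, (u : absoluteGaloisGroup ℚ) • P = P) → P = 0 :=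
    fun r _ P hP => geomTorsion_eq_zero_of_fixed_level W p S hp2 hirr hmk ⊥ r P hP
  have h0m : ∀ r : Finset (HeightOneSpectrum (𝓞 ℚ)), (↑r : Set _) ⊆ D''.primes →
      ∀ P : WeierstrassCurve.geomTorsion W ((p : ℤ) ^ m * (p : ℤ)),
        (∀ u : (𝓛).level ⊥ r, (u : absoluteGaloisGroup ℚ) • P = P) → P = 0 :=
    fun r _ P hP => geomTorsion_eq_zero_of_fixed_level W p S hp2 hirr hmm ⊥ r P hP
  -- the two families (D2), same `σ`
  obtain ⟨Φ, comm, hΦ, κ, hκ0, hκ⟩ := exists_derivativeFamily W p S hc red (Nat.succ_pos k) hM e hec he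
    einv hic h₁ h₂ D.primes hPr hKol σ hσk h0k
  obtain ⟨Φ'', comm'', hΦ'', κ'', hκ0'', hκ''⟩ := exists_derivativeFamily W p S hc red'' (Nat.succ_pos m)
    hM'' e'' hec'' he'' einv'' hic'' h₁'' h₂'' D''.primes hPr'' hKol'' σ hσm h0m
  -- the local clauses for `𝓕_can` at both depths (as in D4)
  have hunr : ∀ (j : ℕ) (w : HeightOneSpectrum (𝓞 ℚ)), W.HasGoodReductionAt w →
      ((primesEquiv w : Nat.Primes) : ℕ) ≠ p →
        unramifiedSubgroup (GaloisRep.toLocal w (W.torsionGaloisModule ((p : ℤ) ^ j * (p : ℤ)))) 1 ≤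
          propagatedSelmerStructure W p j (Sum.inr w) := fun j w hw hne =>
    (propagatedSelmerStructure_inr_eq_unramifiedSubgroup W p j
      (WeierstrassCurve.natCast_not_mem_asIdeal_of_primesEquiv_ne Fact.out hne) hw).ge
  have hSloc : ∀ (j : ℕ), (∀ w : HeightOneSpectrum (𝓞 ℚ), ((primesEquiv w : Nat.Primes) : ℕ) = p →
      propagatedSelmerStructure W p j (Sum.inr w) = ⊤) →
      ∀ (w : HeightOneSpectrum (𝓞 ℚ)), ¬ (W.HasGoodReductionAt w ∧ ((primesEquiv w : Nat.Primes) : ℕ) ≠ p) →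
        propagatedSelmerStructure W p j (Sum.inr w) = ⊤ := by
    intro j htopj w hw
    by_cases hwp : ((primesEquiv w : Nat.Primes) : ℕ) = p
    · exact htopj w hwp
    · exact propagatedSelmerStructure_inr_eq_top_of_torsion_eq_zero W p j
        (WeierstrassCurve.natCast_not_mem_asIdeal_of_primesEquiv_ne Fact.out hwp)
        (hbad w (fun hgood => hw ⟨hgood, hwp⟩) hwp)
  refine ⟨σ, Φ, comm, κ, Φ'', comm'', κ'', hσI, hσχ, hΦ, hΦ'', ?_, ?_, hκ0, hκ0'',
    fun r hr => (hκ r hr).1, fun r hr => (hκ'' r hr).1, fun d hdk hdm => ?_⟩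
  · exact isKolyvaginSystem_derivativeFamily_of_transverse_eq W p S hp2 hc red hred (Nat.succ_pos k) hM
      hmk e hec he einv hic h₁ h₂ D hT hD hPr hKol σ (fun ℓ _ => hσI ℓ) (fun ℓ _ => hσχ ℓ) hσk h0k Φ
      hΦ comm κ hκ0 (fun r hr => (hκ r hr).1) _ (hunr k)
      fun r _ w _ hw => by rw [hSloc k htop w hw]; exact AddSubgroup.mem_top _
  · exact isKolyvaginSystem_derivativeFamily_of_transverse_eq W p S hp2 hc red'' hred'' (Nat.succ_pos m)
      hM'' hmm e'' hec'' he'' einv'' hic'' h₁'' h₂'' D'' hT'' hD'' hPr'' hKol'' σ (fun ℓ _ => hσI ℓ)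
      (fun ℓ _ => hσχ ℓ) hσm h0m Φ'' hΦ'' comm'' κ'' hκ0'' (fun r hr => (hκ'' r hr).1) _ (hunr m)
      fun r _ w _ hw => by rw [hSloc m htop'' w hw]; exact AddSubgroup.mem_top _
  · -- (COMP) on the common levels
    exact map_derivativeFamily_eq W p S hkm red e hcomp red'' e'' hcomp'' π hπ (D.primes ∩ D''.primes)
      (fun ℓ hℓ => hPr hℓ.1) σ Φ hΦ comm κ (fun r hr => hκ r (hr.trans Set.inter_subset_left)) Φ'' hΦ''
      comm'' κ'' (fun r hr => (hκ'' r (hr.trans Set.inter_subset_right)).1) d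
      (Set.subset_inter hdk hdm)

end Summit.BirchSwinnertonDyer.Rank1Residual.GaloisImage.Derivative.Rat

end
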